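import Mathlib
import HarnessLib
import Literature.Analysis.FluidPDE.SelfSimilar
import Literature.Analysis.FluidPDE.TaoEnstrophyLocalisation
import Literature.Analysis.UnboundedOperators.HeatKernelGradient
import Summits.NavierStokesRegularity.NavierStokesRegularity.Theorems.HalfSpaceWindowDoorCirculationCarryingRigidityPlaneFluxDynamics
import Summits.NavierStokesRegularity.NavierStokesRegularity.Theorems.HalfSpaceWindowDoorCirculationCarryingRigidityPlaneFluxHeight
import Summits.NavierStokesRegularity.NavierStokesRegularity.Theorems.ChiralWindowDoorClassDerivDecay
import Summits.NavierStokesRegularity.NavierStokesRegularity.Theorems.HalfSpaceWindowDoorCirculationCarryingRigidityPlaneFluxDecayPairing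

/-!
# Route `HalfSpaceWindowDoor`, crux `CirculationCarryingRigidity` (stmt-NavierStokesRegularity-25311) — CONSERVED PLANE
# CIRCULATION: the plane flux of a closed-hemisphere profile with space–time Type-I decay is independent of TIME (and height)

This completes, in the space–time Type-I subclass (`HasTypeIDecay D`) of the route's class, the planner's «plane-flux heat law»
(informal crux text of 25311: "Φ(z,t) := ∫_{x·e = z} ⟪curl v, e⟫ is finite, independent of z and t"):

* finite: `Φ(c,t) ≤ 4πD` (g0, `…PlaneFlux`);  independent of the height `c`: `…PlaneFluxHeight` (this seat);
* **independent of the time `t`** (`planeFlux_eq_of_class_of_hasTypeIDecay_time`, here), hence one conserved circulation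
  `Φ(c₁,s₁) = Φ(c₂,s₂)` (`planeFlux_conserved_of_class_of_hasTypeIDecay`).

Proof.  By the dynamic windowed law (`…PlaneFluxDynamics.hasDerivAt_windowedFlux_time_of_class`) the windowed flux
`Ψ_L(c,t) = ∫ ω₃(y,c,t) g_{L,0}(y) dy` has `∂ₜΨ_L = −Σᵢ∫∂ᵢω₃∂ᵢg + Σⱼ∫∂₃ωⱼ∂ⱼg + Σⱼ∫Fⱼ∂ⱼg`, SIX pairings of a field `Q` with a
window gradient; under the class decay (`derivDecay_of_class`: `(‖x‖+√(−t))³‖D²v‖ ≤ K`, `(‖x‖+√(−t))²‖Dv‖ ≤ K`, and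
`‖v‖(‖x‖+√(−t)) ≤ D`) every `Q` obeys `|Q(x)|(‖x‖+ρ)³ ≤ A₃` uniformly for `t ∈ [t₁,t₂]` (`ρ = √(−t₂)`), whence
`|∫ Q(y,c) ∂ⱼg_{L,0}(y) dy| ≤ (A₃/(2ρL²))·J(L)`, `J(L) ≤ 1/R + eR²/(4ρL²)`
(`…PlaneFluxDecayPairing.abs_integral_mul_fderiv_gaussWin_le_of_decay`).  So `4πL²|Ψ_L(c,t₂) − Ψ_L(c,t₁)| ≤ 12πA₃(t₂−t₁)J(L)/ρ → 0` (mean value theorem), while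
`4πL²Ψ_L(c,tᵢ) → Φ(c,tᵢ)` (`…PlaneFluxHeight.tendsto_windowedFlux_planeFlux`).

Seat ns-hsw-p1 g2 (LEAD of 25311, cell pub-ns-dss).  WHAT THIS IS NOT: not a statement about Navier–Stokes regularity; the
conserved circulation lives in a SUBCLASS (space–time Type I) of the door's hypothetical profiles and does not by itself
exclude them (the research stub is untouched); helper `--supports` 25311.
-/

noncomputable section

-- the summit and its single sub-problem share the name (CONVENTIONS §1), as in every Theorems file
set_option linter.dupNamespace false

namespace Summit.NavierStokesRegularity.NavierStokesRegularity.Theorems.HalfSpaceWindowDoorCirculationCarryingRigidityPlaneFluxConservation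

open MeasureTheory Set Function Filter Topology Metric
open scoped RealInnerProductSpace InnerProductSpace ENNReal Laplacian ContDiff
open Literature.Analysis Literature.Analysis.FluidPDE Literature.Analysis.UnboundedOperators
open Summit.NavierStokesRegularity.NavierStokesRegularity.Theorems.HalfSpaceWindowDoorCirculationCarryingRigidityDefs
open Summit.NavierStokesRegularity.NavierStokesRegularity.Theorems.HalfSpaceWindowDoorCirculationCarryingRigidityWindowedFlux
  (gaussWin_pos continuous_gaussWin integrable_gaussWin continuous_planePt integrable_fderiv_gaussWin)
open Summit.NavierStokesRegularity.NavierStokesRegularity.Theorems.HalfSpaceWindowDoorCirculationCarryingRigidityPlaneFlux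
  (norm_le_norm_planePt abs_fderiv_gaussWin_zero_apply_le)
open Summit.NavierStokesRegularity.NavierStokesRegularity.Theorems.HalfSpaceWindowDoorCirculationCarryingRigiditySubcriticalStretching
  (fderiv_inner_e3_apply)
open Summit.NavierStokesRegularity.NavierStokesRegularity.Theorems.HalfSpaceWindowDoorCirculationCarryingRigidityPlaneFluxHeightWindow
  (abs_inner_e3_le integral_gaussWin_div_le)
open Summit.NavierStokesRegularity.NavierStokesRegularity.Theorems.HalfSpaceWindowDoorCirculationCarryingRigidityPlaneFluxHeight
  (tendsto_windowedFlux_planeFlux planeFlux_eq_of_class_of_hasTypeIDecay)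
open Summit.NavierStokesRegularity.NavierStokesRegularity.Theorems.HalfSpaceWindowDoorCirculationCarryingRigidityPlaneLaplacian
  (contDiff_two_curl)
open Summit.NavierStokesRegularity.NavierStokesRegularity.Theorems.HalfSpaceWindowDoorCirculationCarryingRigidityPlaneFluxDynamics
  (hasDerivAt_windowedFlux_time_of_class)
open Summit.NavierStokesRegularity.NavierStokesRegularity.Theorems.LocalSineTubeDoorProfileAlignedWindowRigidityAncient
  (bdd_of_hasTypeITimeDecay analyticOnNhd_slice)
open Summit.NavierStokesRegularity.NavierStokesRegularity.Theorems.PoloidalWindowDoorPoloidalWindowRigidityClassSpaceTimeRates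
  (exists_fderiv_rate_of_class')
open Summit.NavierStokesRegularity.NavierStokesRegularity.Theorems.ChiralWindowDoorClassDerivDecay (derivDecay_of_class)
open Summit.NavierStokesRegularity.NavierStokesRegularity.Theorems.RellichScarScarRigidity (norm_fderiv_coord_le_opNorm)
open Summit.NavierStokesRegularity.NavierStokesRegularity.Theorems.HalfSpaceWindowDoorCirculationCarryingRigidityPlaneFluxDecayPairing
  (abs_integral_mul_fderiv_gaussWin_le_of_decay)

/-! ### Conservation in time -/

/-- **PLANE CIRCULATION IS INDEPENDENT OF TIME** for closed-hemisphere profiles with space–time Type-I decay.  For a profile of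
the route's Type-I class (rate `C`, continuity, Oseen–Duhamel identity, divergence-free slices) with `‖v(t,x)‖ ≤ D/(‖x‖+√(−t))`
and `⟪curl v(s), e₃⟫ ≥ 0`: for all `t₁, t₂ < 0` and every height `c`,
`∫⁻_{ℝ²} ⟪curl v(t₁)(y,c), e₃⟫ dy = ∫⁻_{ℝ²} ⟪curl v(t₂)(y,c), e₃⟫ dy`. -/
theorem planeFlux_eq_of_class_of_hasTypeIDecay_time :
    ∀ (C D : ℝ) (v : ℝ → EuclideanSpace ℝ (Fin 3) → EuclideanSpace ℝ (Fin 3)),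
    Literature.Analysis.FluidPDE.HasTypeITimeDecay C v → Literature.Analysis.FluidPDE.HasTypeIDecay D v →
    ContinuousOn (Function.uncurry v) (Set.Iio (0 : ℝ) ×ˢ Set.univ) →
    (∀ s t : ℝ, s < t → t < 0 → ∀ x, v t x =
      Literature.Analysis.UnboundedOperators.heatExtension (v s) (t - s) x -
        Literature.Analysis.FluidPDE.oseenDuhamel 1 s v v t x) →
    (∀ t < 0, Literature.Analysis.FluidPDE.VectorCalculus.IsDivFree (v t)) →
    (∀ s < 0, ∀ y, 0 ≤ ⟪Literature.Analysis.FluidPDE.curl (v s) y, e3⟫_ℝ) →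
    ∀ t₁ < 0, ∀ t₂ < 0, ∀ c : ℝ,
      ∫⁻ y, ENNReal.ofReal ⟪Literature.Analysis.FluidPDE.curl (v t₁) (planePt c y), e3⟫_ℝ =
        ∫⁻ y, ENNReal.ofReal ⟪Literature.Analysis.FluidPDE.curl (v t₂) (planePt c y), e3⟫_ℝ := by
  -- it suffices to treat `t₁ < t₂`
  suffices key : ∀ (C D : ℝ) (v : ℝ → EuclideanSpace ℝ (Fin 3) → EuclideanSpace ℝ (Fin 3)),
      HasTypeITimeDecay C v → HasTypeIDecay D v → ContinuousOn (uncurry v) (Iio (0 : ℝ) ×ˢ univ) →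
      (∀ s t : ℝ, s < t → t < 0 → ∀ x, v t x = heatExtension (v s) (t - s) x - oseenDuhamel 1 s v v t x) →
      (∀ t < 0, VectorCalculus.IsDivFree (v t)) → (∀ s < 0, ∀ y, 0 ≤ ⟪curl (v s) y, e3⟫) →
      ∀ t₁ t₂ : ℝ, t₁ < t₂ → t₂ < 0 → ∀ c : ℝ,
        ∫ y : EuclideanSpace ℝ (Fin 2), ⟪curl (v t₁) (planePt c y), e3⟫ = ∫ y : EuclideanSpace ℝ (Fin 2), ⟪curl (v t₂) (planePt c y), e3⟫ by
    intro C D v hrate hdec hcont hmild hdiv hnn t₁ ht₁ t₂ ht₂ c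
    -- slice data for the real/lintegral conversion
    have hslice : ∀ t < (0 : ℝ), Integrable (fun y : EuclideanSpace ℝ (Fin 2) => ⟪curl (v t) (planePt c y), e3⟫) := by
      intro t ht
      have hA : AnalyticOnNhd ℝ (v t) univ := analyticOnNhd_slice hcont (bdd_of_hasTypeITimeDecay hrate) hmild ht
      have hV2 : ContDiff ℝ 2 (v t) := contDiff_iff_contDiffAt.2 fun x => (hA x (mem_univ x)).contDiffAt
      obtain ⟨K₁, -, hK₁⟩ := exists_fderiv_rate_of_class' hrate hcont hmild
      have hρ : 0 < Real.sqrt (-t) := Real.sqrt_pos.2 (neg_pos.2 ht)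
      have hD : ∀ x, ‖v t x‖ * (‖x‖ + Real.sqrt (-t)) ≤ D := by
        intro x
        have h := hdec t ht x
        rwa [le_div_iff₀ (by positivity)] at h
      exact (tendsto_windowedFlux_planeFlux hV2 (hK₁ t ht) hρ hD (hnn t ht) c).1
    have hreal : ∫ y : EuclideanSpace ℝ (Fin 2), ⟪curl (v t₁) (planePt c y), e3⟫ =
        ∫ y : EuclideanSpace ℝ (Fin 2), ⟪curl (v t₂) (planePt c y), e3⟫ := by
      rcases lt_trichotomy t₁ t₂ with h | h | h
      · exact key C D v hrate hdec hcont hmild hdiv hnn t₁ t₂ h ht₂ c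
      · rw [h]
      · exact (key C D v hrate hdec hcont hmild hdiv hnn t₂ t₁ h ht₁ c).symm
    rw [← ofReal_integral_eq_lintegral_ofReal (hslice t₁ ht₁) (ae_of_all _ fun y => hnn t₁ ht₁ _),
      ← ofReal_integral_eq_lintegral_ofReal (hslice t₂ ht₂) (ae_of_all _ fun y => hnn t₂ ht₂ _), hreal]
  intro C D v hrate hdec hcont hmild hdiv hnn t₁ t₂ h12 ht₂ c
  have ht₁ : t₁ < 0 := h12.trans ht₂
  -- ## decay data, uniform on `[t₁, t₂]` with `ρ = √(−t₂)`
  set ρ : ℝ := Real.sqrt (-t₂) with hρdef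
  have hρ : 0 < ρ := Real.sqrt_pos.2 (neg_pos.2 ht₂)
  have hD0 : 0 ≤ D := by
    have h := hdec (-1) (by norm_num) 0
    have hpos : (0 : ℝ) < ‖(0 : EuclideanSpace ℝ (Fin 3))‖ + Real.sqrt (-(-1)) := by simp
    have h' : 0 ≤ D / (‖(0 : EuclideanSpace ℝ (Fin 3))‖ + Real.sqrt (-(-1))) := (norm_nonneg _).trans h
    exact (div_nonneg_iff.1 h').elim (fun h'' => h''.1) fun h'' => absurd h''.2 (not_le.2 hpos)
  obtain ⟨K, hK⟩ := derivDecay_of_class C D v hrate hdec hcont hmild hdiv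
  have hK0 : 0 ≤ K := by
    obtain ⟨h1, -, -⟩ := hK (-1) (by norm_num) 0
    exact le_trans (by positivity) h1
  have hρt : ∀ t ∈ Icc t₁ t₂, ρ ≤ Real.sqrt (-t) := fun t ht => Real.sqrt_le_sqrt (by linarith [ht.2])
  have hIneg : ∀ t ∈ Icc t₁ t₂, t < 0 := fun t ht => lt_of_le_of_lt ht.2 ht₂
  -- smoothness of slices
  have hsm : ∀ t < (0 : ℝ), ContDiff ℝ 3 (v t) := by
    intro t ht
    have hA := analyticOnNhd_slice hcont (bdd_of_hasTypeITimeDecay hrate) hmild ht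
    exact contDiff_iff_contDiffAt.2 fun x => (hA x (mem_univ x)).contDiffAt
  -- the three decaying fields on `[t₁, t₂]`: velocity, vorticity, vorticity gradient
  have hvel : ∀ t ∈ Icc t₁ t₂, ∀ x, ‖v t x‖ * (‖x‖ + ρ) ≤ D := by
    intro t ht x
    have h := hdec t (hIneg t ht) x
    have hst : 0 < Real.sqrt (-t) := Real.sqrt_pos.2 (neg_pos.2 (hIneg t ht))
    have hpos : 0 < ‖x‖ + Real.sqrt (-t) := add_pos_of_nonneg_of_pos (norm_nonneg _) hst
    rw [le_div_iff₀ hpos] at h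
    calc ‖v t x‖ * (‖x‖ + ρ) ≤ ‖v t x‖ * (‖x‖ + Real.sqrt (-t)) := by gcongr; exact hρt t ht
      _ ≤ D := h
  have hgrad : ∀ t ∈ Icc t₁ t₂, ∀ x, ‖fderiv ℝ (v t) x‖ * (‖x‖ + ρ) ^ 2 ≤ K := by
    intro t ht x
    obtain ⟨h1, -, -⟩ := hK t (hIneg t ht) x
    calc ‖fderiv ℝ (v t) x‖ * (‖x‖ + ρ) ^ 2 ≤ ‖fderiv ℝ (v t) x‖ * (‖x‖ + Real.sqrt (-t)) ^ 2 := by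
          gcongr; exact hρt t ht
      _ ≤ K := by rw [mul_comm]; exact h1
  have hhess : ∀ t ∈ Icc t₁ t₂, ∀ x, ‖fderiv ℝ (curl (v t)) x‖ * (‖x‖ + ρ) ^ 3 ≤ ‖curlCLM‖ * K := by
    intro t ht x
    obtain ⟨-, h2, -⟩ := hK t (hIneg t ht) x
    calc ‖fderiv ℝ (curl (v t)) x‖ * (‖x‖ + ρ) ^ 3
        ≤ (‖curlCLM‖ * ‖iteratedFDeriv ℝ 2 (v t) x‖) * (‖x‖ + Real.sqrt (-t)) ^ 3 := by
          gcongr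
          · exact FluidPDE.norm_fderiv_curl_le ((hsm t (hIneg t ht)).of_le (by norm_cast)) x
          · exact hρt t ht
      _ = ‖curlCLM‖ * ((‖x‖ + Real.sqrt (-t)) ^ 3 * ‖iteratedFDeriv ℝ 2 (v t) x‖) := by ring
      _ ≤ ‖curlCLM‖ * K := mul_le_mul_of_nonneg_left h2 (norm_nonneg curlCLM)
  -- one constant for all six fields
  set A₃ : ℝ := ‖curlCLM‖ * K + 8 * D * K with hA₃
  have hA₃1 : ‖curlCLM‖ * K ≤ A₃ := by rw [hA₃]; nlinarith [norm_nonneg curlCLM]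
  have hA₃2 : 8 * D * K ≤ A₃ := by rw [hA₃]; nlinarith [norm_nonneg curlCLM]
  -- ## the decay of the six integrands at a time `t ∈ [t₁, t₂]`
  have hQ1 : ∀ t ∈ Icc t₁ t₂, ∀ (e : EuclideanSpace ℝ (Fin 3)), ‖e‖ = 1 → ∀ x,
      |fderiv ℝ (fun z => ⟪curl (v t) z, e3⟫) x e| * (‖x‖ + ρ) ^ 3 ≤ A₃ := by
    intro t ht e he x
    have hWd : Differentiable ℝ (curl (v t)) := (contDiff_two_curl (hsm t (hIneg t ht))).differentiable two_ne_zero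
    rw [fderiv_inner_e3_apply (hWd x)]
    calc |⟪fderiv ℝ (curl (v t)) x e, e3⟫| * (‖x‖ + ρ) ^ 3 ≤ ‖fderiv ℝ (curl (v t)) x e‖ * (‖x‖ + ρ) ^ 3 := by
          gcongr; exact abs_inner_e3_le _
      _ ≤ (‖fderiv ℝ (curl (v t)) x‖ * ‖e‖) * (‖x‖ + ρ) ^ 3 := by gcongr; exact ContinuousLinearMap.le_opNorm _ _
      _ = ‖fderiv ℝ (curl (v t)) x‖ * (‖x‖ + ρ) ^ 3 := by rw [he, mul_one]
      _ ≤ A₃ := (hhess t ht x).trans hA₃1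
  have hQ2 : ∀ t ∈ Icc t₁ t₂, ∀ (j : Fin 3) x,
      |fderiv ℝ (fun z => curl (v t) z j) x e3| * (‖x‖ + ρ) ^ 3 ≤ A₃ := by
    intro t ht j x
    have hWd : Differentiable ℝ (curl (v t)) := (contDiff_two_curl (hsm t (hIneg t ht))).differentiable two_ne_zero
    have he3 : ‖e3‖ = 1 := by rw [e3, PiLp.norm_single, norm_one]
    calc |fderiv ℝ (fun z => curl (v t) z j) x e3| * (‖x‖ + ρ) ^ 3
        ≤ (‖fderiv ℝ (fun z => curl (v t) z j) x‖ * ‖e3‖) * (‖x‖ + ρ) ^ 3 := by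
          gcongr; rw [← Real.norm_eq_abs]; exact ContinuousLinearMap.le_opNorm _ _
      _ ≤ (‖fderiv ℝ (curl (v t)) x‖ * 1) * (‖x‖ + ρ) ^ 3 := by
          rw [he3]; gcongr; exact norm_fderiv_coord_le_opNorm (hWd x) j
      _ = ‖fderiv ℝ (curl (v t)) x‖ * (‖x‖ + ρ) ^ 3 := by ring
      _ ≤ A₃ := (hhess t ht x).trans hA₃1
  have hQ3 : ∀ t ∈ Icc t₁ t₂, ∀ (j : Fin 3) x,
      |v t x j * curl (v t) x 2 - curl (v t) x j * v t x 2| * (‖x‖ + ρ) ^ 3 ≤ A₃ := by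
    intro t ht j x
    have h1 : |v t x j| ≤ ‖v t x‖ := by rw [← Real.norm_eq_abs]; exact PiLp.norm_apply_le _ _
    have h2 : |curl (v t) x 2| ≤ ‖curl (v t) x‖ := by rw [← Real.norm_eq_abs]; exact PiLp.norm_apply_le _ _
    have h3 : |curl (v t) x j| ≤ ‖curl (v t) x‖ := by rw [← Real.norm_eq_abs]; exact PiLp.norm_apply_le _ _
    have h4 : |v t x 2| ≤ ‖v t x‖ := by rw [← Real.norm_eq_abs]; exact PiLp.norm_apply_le _ _
    have hprod : |v t x j * curl (v t) x 2 - curl (v t) x j * v t x 2| ≤ 2 * (‖v t x‖ * ‖curl (v t) x‖) := by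
      calc |v t x j * curl (v t) x 2 - curl (v t) x j * v t x 2|
          ≤ |v t x j * curl (v t) x 2| + |curl (v t) x j * v t x 2| := abs_sub _ _
        _ = |v t x j| * |curl (v t) x 2| + |curl (v t) x j| * |v t x 2| := by rw [abs_mul, abs_mul]
        _ ≤ ‖v t x‖ * ‖curl (v t) x‖ + ‖curl (v t) x‖ * ‖v t x‖ := by
            gcongr
        _ = 2 * (‖v t x‖ * ‖curl (v t) x‖) := by ring
    have hω : ‖curl (v t) x‖ * (‖x‖ + ρ) ^ 2 ≤ 4 * K := by
      calc ‖curl (v t) x‖ * (‖x‖ + ρ) ^ 2 ≤ (4 * ‖fderiv ℝ (v t) x‖) * (‖x‖ + ρ) ^ 2 := by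
            gcongr; exact norm_curl_le_four_mul (v t) x
        _ = 4 * (‖fderiv ℝ (v t) x‖ * (‖x‖ + ρ) ^ 2) := by ring
        _ ≤ 4 * K := by linarith [hgrad t ht x]
    have hpos : 0 ≤ ‖x‖ + ρ := by positivity
    calc |v t x j * curl (v t) x 2 - curl (v t) x j * v t x 2| * (‖x‖ + ρ) ^ 3
        ≤ 2 * (‖v t x‖ * ‖curl (v t) x‖) * (‖x‖ + ρ) ^ 3 := by gcongr
      _ = 2 * ((‖v t x‖ * (‖x‖ + ρ)) * (‖curl (v t) x‖ * (‖x‖ + ρ) ^ 2)) := by ring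
      _ ≤ 2 * (D * (4 * K)) :=
          mul_le_mul_of_nonneg_left (mul_le_mul (hvel t ht x) hω (mul_nonneg (norm_nonneg _) (by positivity)) hD0)
            (by norm_num)
      _ = 8 * D * K := by ring
      _ ≤ A₃ := hA₃2
  -- continuity of the six integrands' fields at a time `t < 0`
  have hcQ1 : ∀ t < (0 : ℝ), ∀ e : EuclideanSpace ℝ (Fin 3), Continuous fun x => fderiv ℝ (fun z => ⟪curl (v t) z, e3⟫) x e := by
    intro t ht e
    have hf2 : ContDiff ℝ 2 (fun z => ⟪curl (v t) z, e3⟫) := (contDiff_two_curl (hsm t ht)).inner ℝ contDiff_const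
    exact (hf2.continuous_fderiv two_ne_zero).clm_apply continuous_const
  have hcQ2 : ∀ t < (0 : ℝ), ∀ j : Fin 3, Continuous fun x => fderiv ℝ (fun z => curl (v t) z j) x e3 := by
    intro t ht j
    have hG : ContDiff ℝ 2 (fun z => curl (v t) z j) := (EuclideanSpace.proj (𝕜 := ℝ) j).contDiff.comp (contDiff_two_curl (hsm t ht))
    exact (hG.continuous_fderiv two_ne_zero).clm_apply continuous_const
  have hcQ3 : ∀ t < (0 : ℝ), ∀ j : Fin 3, Continuous fun x => v t x j * curl (v t) x 2 - curl (v t) x j * v t x 2 := by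
    intro t ht j
    have hvc : Continuous (v t) := (hsm t ht).continuous
    have hwc : Continuous (curl (v t)) := (contDiff_two_curl (hsm t ht)).continuous
    have hc : ∀ i : Fin 3, Continuous fun x => v t x i := fun i => (EuclideanSpace.proj (𝕜 := ℝ) i).continuous.comp hvc
    have hw : ∀ i : Fin 3, Continuous fun x => curl (v t) x i := fun i => (EuclideanSpace.proj (𝕜 := ℝ) i).continuous.comp hwc
    exact ((hc j).mul (hw 2)).sub ((hw j).mul (hc 2))
  -- ## the windowed fluxes `b_n(t) = 4π(n+1)² Ψ_{n+1}(c,t)` and the bound on their time variation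
  have hsingle : ∀ i : Fin 2, ‖(EuclideanSpace.single (Fin.castSucc i) (1 : ℝ) : EuclideanSpace ℝ (Fin 3))‖ = 1 := fun i => by
    rw [PiLp.norm_single, norm_one]
  have hvar : ∀ n : ℕ, |(∫ y, ⟪curl (v t₂) (planePt c y), e3⟫ * gaussWin ((n : ℝ) + 1) 0 y) -
      (∫ y, ⟪curl (v t₁) (planePt c y), e3⟫ * gaussWin ((n : ℝ) + 1) 0 y)| ≤
      6 * (A₃ / (2 * ρ * ((n : ℝ) + 1) ^ 2) * (1 / Real.sqrt ((n : ℝ) + 1) +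
        Real.exp 1 * (Real.sqrt ((n : ℝ) + 1)) ^ 2 / (4 * ρ * ((n : ℝ) + 1) ^ 2))) * |t₂ - t₁| := by
    intro n
    set L : ℝ := (n : ℝ) + 1 with hLdef
    have hL : 0 < L := by positivity
    have hR : 0 < Real.sqrt L := Real.sqrt_pos.2 hL
    set ε : ℝ := A₃ / (2 * ρ * L ^ 2) * (1 / Real.sqrt L + Real.exp 1 * (Real.sqrt L) ^ 2 / (4 * ρ * L ^ 2)) with hε
    -- derivative bound at every `t ∈ [t₁, t₂]`
    have hder : ∀ t ∈ Icc t₁ t₂, HasDerivWithinAt (fun s => ∫ y, ⟪curl (v s) (planePt c y), e3⟫ * gaussWin L 0 y)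
        ((-((∫ y, fderiv ℝ (fun z => ⟪curl (v t) z, e3⟫) (planePt c y) (EuclideanSpace.single 0 1) *
                fderiv ℝ (gaussWin L 0) y (EuclideanSpace.single 0 1)) +
              ∫ y, fderiv ℝ (fun z => ⟪curl (v t) z, e3⟫) (planePt c y) (EuclideanSpace.single 1 1) *
                fderiv ℝ (gaussWin L 0) y (EuclideanSpace.single 1 1)) +
            ((∫ y, fderiv ℝ (fun z => curl (v t) z 0) (planePt c y) e3 * fderiv ℝ (gaussWin L 0) y (EuclideanSpace.single 0 1)) +
              ∫ y, fderiv ℝ (fun z => curl (v t) z 1) (planePt c y) e3 * fderiv ℝ (gaussWin L 0) y (EuclideanSpace.single 1 1))) -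
          (-(∫ y, (v t (planePt c y) 0 * curl (v t) (planePt c y) 2 - curl (v t) (planePt c y) 0 * v t (planePt c y) 2) *
                fderiv ℝ (gaussWin L 0) y (EuclideanSpace.single 0 1)) -
            ∫ y, (v t (planePt c y) 1 * curl (v t) (planePt c y) 2 - curl (v t) (planePt c y) 1 * v t (planePt c y) 2) *
                fderiv ℝ (gaussWin L 0) y (EuclideanSpace.single 1 1))) (Icc t₁ t₂) t :=
      fun t ht => (hasDerivAt_windowedFlux_time_of_class C v hrate hcont hmild hdiv t (hIneg t ht) L hL c).hasDerivWithinAt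
    have hbound : ∀ t ∈ Icc t₁ t₂,
        ‖(-((∫ y, fderiv ℝ (fun z => ⟪curl (v t) z, e3⟫) (planePt c y) (EuclideanSpace.single 0 1) *
                fderiv ℝ (gaussWin L 0) y (EuclideanSpace.single 0 1)) +
              ∫ y, fderiv ℝ (fun z => ⟪curl (v t) z, e3⟫) (planePt c y) (EuclideanSpace.single 1 1) *
                fderiv ℝ (gaussWin L 0) y (EuclideanSpace.single 1 1)) +
            ((∫ y, fderiv ℝ (fun z => curl (v t) z 0) (planePt c y) e3 * fderiv ℝ (gaussWin L 0) y (EuclideanSpace.single 0 1)) +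
              ∫ y, fderiv ℝ (fun z => curl (v t) z 1) (planePt c y) e3 * fderiv ℝ (gaussWin L 0) y (EuclideanSpace.single 1 1))) -
          (-(∫ y, (v t (planePt c y) 0 * curl (v t) (planePt c y) 2 - curl (v t) (planePt c y) 0 * v t (planePt c y) 2) *
                fderiv ℝ (gaussWin L 0) y (EuclideanSpace.single 0 1)) -
            ∫ y, (v t (planePt c y) 1 * curl (v t) (planePt c y) 2 - curl (v t) (planePt c y) 1 * v t (planePt c y) 2) *
                fderiv ℝ (gaussWin L 0) y (EuclideanSpace.single 1 1))‖ ≤ 6 * ε := by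
      intro t ht
      have ht0 := hIneg t ht
      have e0 : (EuclideanSpace.single (Fin.castSucc (0 : Fin 2)) (1 : ℝ) : EuclideanSpace ℝ (Fin 3)) = EuclideanSpace.single 0 1 := rfl
      have e1 : (EuclideanSpace.single (Fin.castSucc (1 : Fin 2)) (1 : ℝ) : EuclideanSpace ℝ (Fin 3)) = EuclideanSpace.single 1 1 := rfl
      -- the six bounds
      have b1 := (abs_integral_mul_fderiv_gaussWin_le_of_decay (hcQ1 t ht0 (EuclideanSpace.single 0 1)) hρ
        (hQ1 t ht _ (by rw [PiLp.norm_single, norm_one])) hL hR c 0).2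
      have b2 := (abs_integral_mul_fderiv_gaussWin_le_of_decay (hcQ1 t ht0 (EuclideanSpace.single 1 1)) hρ
        (hQ1 t ht _ (by rw [PiLp.norm_single, norm_one])) hL hR c 1).2
      have b3 := (abs_integral_mul_fderiv_gaussWin_le_of_decay (hcQ2 t ht0 0) hρ (hQ2 t ht 0) hL hR c 0).2
      have b4 := (abs_integral_mul_fderiv_gaussWin_le_of_decay (hcQ2 t ht0 1) hρ (hQ2 t ht 1) hL hR c 1).2
      have b5 := (abs_integral_mul_fderiv_gaussWin_le_of_decay (hcQ3 t ht0 0) hρ (hQ3 t ht 0) hL hR c 0).2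
      have b6 := (abs_integral_mul_fderiv_gaussWin_le_of_decay (hcQ3 t ht0 1) hρ (hQ3 t ht 1) hL hR c 1).2
      rw [Real.norm_eq_abs]
      -- abbreviate the six integrals
      set I1 := ∫ y, fderiv ℝ (fun z => ⟪curl (v t) z, e3⟫) (planePt c y) (EuclideanSpace.single 0 1) *
        fderiv ℝ (gaussWin L 0) y (EuclideanSpace.single 0 1)
      set I2 := ∫ y, fderiv ℝ (fun z => ⟪curl (v t) z, e3⟫) (planePt c y) (EuclideanSpace.single 1 1) *
        fderiv ℝ (gaussWin L 0) y (EuclideanSpace.single 1 1)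
      set I3 := ∫ y, fderiv ℝ (fun z => curl (v t) z 0) (planePt c y) e3 * fderiv ℝ (gaussWin L 0) y (EuclideanSpace.single 0 1)
      set I4 := ∫ y, fderiv ℝ (fun z => curl (v t) z 1) (planePt c y) e3 * fderiv ℝ (gaussWin L 0) y (EuclideanSpace.single 1 1)
      set I5 := ∫ y, (v t (planePt c y) 0 * curl (v t) (planePt c y) 2 - curl (v t) (planePt c y) 0 * v t (planePt c y) 2) *
        fderiv ℝ (gaussWin L 0) y (EuclideanSpace.single 0 1)
      set I6 := ∫ y, (v t (planePt c y) 1 * curl (v t) (planePt c y) 2 - curl (v t) (planePt c y) 1 * v t (planePt c y) 2) *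
        fderiv ℝ (gaussWin L 0) y (EuclideanSpace.single 1 1)
      have h : |(-(I1 + I2) + (I3 + I4)) - (-I5 - I6)| ≤ |I1| + |I2| + |I3| + |I4| + |I5| + |I6| := by
        have := abs_add_le (-(I1 + I2) + (I3 + I4)) (-(-I5 - I6))
        have h2 := abs_add_le (-(I1 + I2)) (I3 + I4)
        have h3 := abs_add_le I1 I2
        have h4 := abs_add_le I3 I4
        have h5 := abs_add_le I5 I6
        rw [abs_neg] at h2
        rw [sub_eq_add_neg]
        have h6 : |-(-I5 - I6)| = |I5 + I6| := by rw [abs_neg, show -I5 - I6 = -(I5 + I6) by ring, abs_neg]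
        linarith
      linarith
    have hmvt := Convex.norm_image_sub_le_of_norm_hasDerivWithin_le hder hbound (convex_Icc t₁ t₂)
      (left_mem_Icc.2 h12.le) (right_mem_Icc.2 h12.le)
    rw [Real.norm_eq_abs, Real.norm_eq_abs] at hmvt
    exact hmvt
  -- ## the limits
  have hten : ∀ t < (0 : ℝ), Tendsto (fun n : ℕ => 4 * Real.pi * ((n : ℝ) + 1) ^ 2 *
      ∫ y, ⟪curl (v t) (planePt c y), e3⟫ * gaussWin ((n : ℝ) + 1) 0 y) atTop
      (𝓝 (∫ y : EuclideanSpace ℝ (Fin 2), ⟪curl (v t) (planePt c y), e3⟫)) := by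
    intro t ht
    have hV2 : ContDiff ℝ 2 (v t) := (hsm t ht).of_le (by norm_cast)
    obtain ⟨K₁, -, hK₁⟩ := exists_fderiv_rate_of_class' hrate hcont hmild
    have hρ' : 0 < Real.sqrt (-t) := Real.sqrt_pos.2 (neg_pos.2 ht)
    have hD' : ∀ x, ‖v t x‖ * (‖x‖ + Real.sqrt (-t)) ≤ D := by
      intro x
      have h := hdec t ht x
      rwa [le_div_iff₀ (by positivity)] at h
    exact (tendsto_windowedFlux_planeFlux hV2 (hK₁ t ht) hρ' hD' (hnn t ht) c).2
  have hdiff : Tendsto (fun n : ℕ => 4 * Real.pi * ((n : ℝ) + 1) ^ 2 *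
      (∫ y, ⟪curl (v t₂) (planePt c y), e3⟫ * gaussWin ((n : ℝ) + 1) 0 y) -
        4 * Real.pi * ((n : ℝ) + 1) ^ 2 * (∫ y, ⟪curl (v t₁) (planePt c y), e3⟫ * gaussWin ((n : ℝ) + 1) 0 y)) atTop (𝓝 0) := by
    have hbd : ∀ n : ℕ, |4 * Real.pi * ((n : ℝ) + 1) ^ 2 *
        (∫ y, ⟪curl (v t₂) (planePt c y), e3⟫ * gaussWin ((n : ℝ) + 1) 0 y) -
          4 * Real.pi * ((n : ℝ) + 1) ^ 2 * (∫ y, ⟪curl (v t₁) (planePt c y), e3⟫ * gaussWin ((n : ℝ) + 1) 0 y)| ≤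
        4 * Real.pi * (3 * A₃ / ρ) * (1 / Real.sqrt ((n : ℝ) + 1) +
          Real.exp 1 * (Real.sqrt ((n : ℝ) + 1)) ^ 2 / (4 * ρ * ((n : ℝ) + 1) ^ 2)) * |t₂ - t₁| := by
      intro n
      have hL : (0 : ℝ) < (n : ℝ) + 1 := by positivity
      have hL2 : 0 < 4 * Real.pi * ((n : ℝ) + 1) ^ 2 := by positivity
      rw [← mul_sub, abs_mul, abs_of_pos hL2]
      calc 4 * Real.pi * ((n : ℝ) + 1) ^ 2 * |(∫ y, ⟪curl (v t₂) (planePt c y), e3⟫ * gaussWin ((n : ℝ) + 1) 0 y) -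
            ∫ y, ⟪curl (v t₁) (planePt c y), e3⟫ * gaussWin ((n : ℝ) + 1) 0 y|
          ≤ 4 * Real.pi * ((n : ℝ) + 1) ^ 2 * (6 * (A₃ / (2 * ρ * ((n : ℝ) + 1) ^ 2) * (1 / Real.sqrt ((n : ℝ) + 1) +
              Real.exp 1 * (Real.sqrt ((n : ℝ) + 1)) ^ 2 / (4 * ρ * ((n : ℝ) + 1) ^ 2))) * |t₂ - t₁|) :=
            mul_le_mul_of_nonneg_left (hvar n) hL2.le
        _ = 4 * Real.pi * (3 * A₃ / ρ) * (1 / Real.sqrt ((n : ℝ) + 1) +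
              Real.exp 1 * (Real.sqrt ((n : ℝ) + 1)) ^ 2 / (4 * ρ * ((n : ℝ) + 1) ^ 2)) * |t₂ - t₁| := by
            field_simp
            ring
    have hε : Tendsto (fun n : ℕ => 4 * Real.pi * (3 * A₃ / ρ) * (1 / Real.sqrt ((n : ℝ) + 1) +
        Real.exp 1 * (Real.sqrt ((n : ℝ) + 1)) ^ 2 / (4 * ρ * ((n : ℝ) + 1) ^ 2)) * |t₂ - t₁|) atTop (𝓝 0) := by
      have hn1 : Tendsto (fun n : ℕ => (n : ℝ) + 1) atTop atTop :=
        tendsto_atTop_add_const_right _ _ tendsto_natCast_atTop_atTop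
      have ha : Tendsto (fun n : ℕ => 1 / Real.sqrt ((n : ℝ) + 1)) atTop (𝓝 0) :=
        tendsto_const_nhds.div_atTop (Real.tendsto_sqrt_atTop.comp hn1)
      have hb : Tendsto (fun n : ℕ => Real.exp 1 * (Real.sqrt ((n : ℝ) + 1)) ^ 2 / (4 * ρ * ((n : ℝ) + 1) ^ 2))
          atTop (𝓝 0) := by
        have hfun : (fun n : ℕ => Real.exp 1 * (Real.sqrt ((n : ℝ) + 1)) ^ 2 / (4 * ρ * ((n : ℝ) + 1) ^ 2)) =
            fun n : ℕ => (Real.exp 1 / (4 * ρ)) / ((n : ℝ) + 1) := by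
          funext n
          have hL : (0 : ℝ) < (n : ℝ) + 1 := by positivity
          rw [Real.sq_sqrt hL.le]
          field_simp
        rw [hfun]
        exact tendsto_const_nhds.div_atTop hn1
      have h := ((ha.add hb).const_mul (4 * Real.pi * (3 * A₃ / ρ))).mul_const |t₂ - t₁|
      simpa using h
    exact squeeze_zero_norm (fun n => by rw [Real.norm_eq_abs]; exact hbd n) hε
  have hsub := (hten t₂ ht₂).sub (hten t₁ ht₁)
  have h0 := tendsto_nhds_unique hsub hdiff
  linarith

/-- **CONSERVED PLANE CIRCULATION.**  For a closed-hemisphere profile of the route's Type-I class with space–time Type-I decay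
`D`, the plane flux `Φ(c,s) = ∫⁻_{ℝ²} ⟪curl v(s)(y,c), e₃⟫ dy` is one number: `Φ(c₁,s₁) = Φ(c₂,s₂)` for all heights and all
negative times (and `Φ ≤ 4πD`, g0's `planeFlux_le_of_class_of_hasTypeIDecay`). -/
theorem planeFlux_conserved_of_class_of_hasTypeIDecay :
    ∀ (C D : ℝ) (v : ℝ → EuclideanSpace ℝ (Fin 3) → EuclideanSpace ℝ (Fin 3)),
    Literature.Analysis.FluidPDE.HasTypeITimeDecay C v → Literature.Analysis.FluidPDE.HasTypeIDecay D v →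
    ContinuousOn (Function.uncurry v) (Set.Iio (0 : ℝ) ×ˢ Set.univ) →
    (∀ s t : ℝ, s < t → t < 0 → ∀ x, v t x =
      Literature.Analysis.UnboundedOperators.heatExtension (v s) (t - s) x -
        Literature.Analysis.FluidPDE.oseenDuhamel 1 s v v t x) →
    (∀ t < 0, Literature.Analysis.FluidPDE.VectorCalculus.IsDivFree (v t)) →
    (∀ s < 0, ∀ y, 0 ≤ ⟪Literature.Analysis.FluidPDE.curl (v s) y, e3⟫_ℝ) →
    ∀ s₁ < 0, ∀ s₂ < 0, ∀ c₁ c₂ : ℝ,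
      ∫⁻ y, ENNReal.ofReal ⟪Literature.Analysis.FluidPDE.curl (v s₁) (planePt c₁ y), e3⟫_ℝ =
        ∫⁻ y, ENNReal.ofReal ⟪Literature.Analysis.FluidPDE.curl (v s₂) (planePt c₂ y), e3⟫_ℝ := by
  intro C D v hrate hdec hcont hmild hdiv hnn s₁ hs₁ s₂ hs₂ c₁ c₂
  rw [planeFlux_eq_of_class_of_hasTypeIDecay C D v hrate hdec hcont hmild hdiv hnn s₁ hs₁ c₁ c₂,
    planeFlux_eq_of_class_of_hasTypeIDecay_time C D v hrate hdec hcont hmild hdiv hnn s₁ hs₁ s₂ hs₂ c₂]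

end Summit.NavierStokesRegularity.NavierStokesRegularity.Theorems.HalfSpaceWindowDoorCirculationCarryingRigidityPlaneFluxConservation

end
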